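import Literature.LinearAlgebra.Matrix.CommutantEigencharacters
import Literature.LinearAlgebra.Matrix.UnitaryFormAdjointCayley
import Mathlib.Topology.Algebra.Module.FiniteDimension
import Mathlib.Topology.Instances.Matrix
import Mathlib.FieldTheory.IsAlgClosed.AlgebraicClosure
import HarnessLib

/-!
# The singular locus of the centraliser of a regular unitary element lies in finitely many closed, non-open subgroups (root kernels)

Topic `LinearAlgebra/Matrix`; namespace `Literature.LinearAlgebra.Matrix`.  PROOF FILE: theorems only (no definition, no named fact, no instance, no
notation, no `sorry`) over Mathlib, ★ `CommutantEigencharacters` and ★ `UnitaryFormAdjointCayley`.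

SETTING.  `K` a complete non-trivially normed field with `2 ≠ 0`, `σ : K →+* K`, `J ∈ M_n(K)` with unit determinant, `U = U(σ, J) ≤ GL_n(K)` the tree's
`unitaryGroupOfForm σ J`; `γ₀ ∈ U` REGULAR SEMISIMPLE (separable characteristic polynomial); `T = Z_U(γ₀)` its centraliser in `U` (a Cartan subgroup when
`U` is a unitary group over a local field, [Rogawski1990, §3.6]; [Borel1991, IV.12]).  We assume an element `δ ≠ 0` with `σ δ = −δ` and a sequence `ε_k → 0`
of non-zero `σ`-fixed scalars (for a quadratic Galois involution `σ` of a local field: `δ = a − σ a`, `ε_k = ϖ^k` with `ϖ` in the fixed field).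

RESULT **`exists_finset_subgroup_cover_singular_centralizer`**: there is a finite set `s` of subgroups of `T`, each CLOSED and NOT OPEN in `T`, such that
every `t ∈ T` whose characteristic polynomial is NOT separable lies in a member of `s`.  (So for every inner-regular Haar measure on a locally compact `T`
the singular set is null — Steinhaus; this consequence is drawn by the consumers, e.g. the CM unitary groups of the `hodgecm-mathlib` cell, crux H413,
★ `Summit.….F0P3cStCharTSCartanNull.ae_isRegularElt_of_rootKernels`.)  [HarishChandra1970, Lemma 42]: «the set of singular elements of a Cartan subgroup
has measure zero».

PROOF.  Eigencharacters `χ_i : M_n(K) → K̄` of the commutant of `γ₀` (★ `exists_eigencharacters`): `charpoly t = ∏ (X − χ_i t)` for `t ∈ T`, so a singular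
`t` lies in a ROOT KERNEL `H_{ij} = {t ∈ T | χ_i t = χ_j t}`, `i ≠ j` — a subgroup (multiplicativity), CLOSED (the kernel of the `K`-linear `χ_i − χ_j` on the
finite-dimensional `M_n(K)` is closed, Mathlib `Submodule.closed_of_finiteDimensional`), and NOT OPEN: with `θ = θ_J` the form adjoint, `X₁ = γ₀ − γ₀⁻¹` and
`X₂ = δ(γ₀ + γ₀⁻¹)` are `θ`-skew elements of the commutant, and `χ_i − χ_j` cannot kill both (else `2χ_i(γ₀) = 2χ_j(γ₀)`); for such an `X` the Cayley
transforms `u_k = c(ε_k X) = (1 − ε_k X)(1 + ε_k X)⁻¹` lie in `T` (★ `cayley_mem_unitaryGroupOfForm`, ★ `commute_cayley`), tend to `1`, and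
`χ_i(u_k) = χ_j(u_k) ⟺ 2 ε_k (χ_j X − χ_i X) = 0`, never.  [Weyl1939, Ch. II §10] for the Cayley parametrisation.

## References
* [HarishChandra1970] Harish-Chandra (notes by G. van Dijk), *Harmonic Analysis on Reductive p-adic Groups*, LNM 162 (1970), Lemma 42.
* [Rogawski1990] J. D. Rogawski, *Automorphic Representations of Unitary Groups in Three Variables*, Ann. of Math. Stud. 123 (1990), §3.6 pp. 28–31.
* [Borel1991] A. Borel, *Linear Algebraic Groups*, 2nd ed. (1991), IV.12.2.
* [Weyl1939] H. Weyl, *The Classical Groups* (1939), Ch. II §10.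
-/

set_option autoImplicit false

noncomputable section

open Filter Topology Polynomial
open scoped Matrix MatrixGroups

namespace Literature.LinearAlgebra.Matrix

open Literature.NumberTheory.Automorphic Literature.Analysis.Calculus

section Skew

variable {K : Type*} [CommRing K] {n : Type*} [Fintype n] [DecidableEq n] (σ : K →+* K) {J : Matrix n n K}

omit [Fintype n] [DecidableEq n] in
/-- `σ` applied entrywise to a scalar multiple: `(δ • Y)^σ = σ(δ) • Y^σ`. [cite: PlatonovRapinchuk1994, §2.3] -/
theorem map_smul_eq_smul_map (δ : K) (Y : Matrix n n K) : (δ • Y).map σ = σ δ • Y.map σ := by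
  ext i j
  simp only [Matrix.map_apply, Matrix.smul_apply, smul_eq_mul, map_mul]

/-- The form adjoint `θ_J X = J⁻¹ (X^σ)ᵀ J` is `σ`-SEMILINEAR: `θ_J (δ • Y) = σ(δ) • θ_J Y`. [cite: PlatonovRapinchuk1994, §2.3] -/
theorem formAdjoint_smul (δ : K) (Y : Matrix n n K) :
    J⁻¹ * ((δ • Y).map σ)ᵀ * J = σ δ • (J⁻¹ * (Y.map σ)ᵀ * J) := by
  rw [map_smul_eq_smul_map, Matrix.transpose_smul, Matrix.mul_smul, Matrix.smul_mul]

/-- **The two skew elements of the commutant of a unitary `γ₀`**: `X₁ = γ₀ − γ₀⁻¹` satisfies `θ_J X₁ = −X₁`. [cite: Weyl1939, Ch. II §10] -/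
theorem formAdjoint_sub_inv_eq_neg (hJ : IsUnit J.det) {γ₀ : GL n K} (hγ₀ : γ₀ ∈ unitaryGroupOfForm σ J) :
    J⁻¹ * (((γ₀ : Matrix n n K) - ((γ₀⁻¹ : GL n K) : Matrix n n K)).map σ)ᵀ * J =
      -((γ₀ : Matrix n n K) - ((γ₀⁻¹ : GL n K) : Matrix n n K)) := by
  rw [formAdjoint_sub, formAdjoint_coe_eq_coe_inv σ hJ hγ₀, formAdjoint_coe_eq_coe_inv σ hJ ((unitaryGroupOfForm σ J).inv_mem hγ₀), inv_inv,
    neg_sub]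

/-- `X₂ = δ (γ₀ + γ₀⁻¹)` satisfies `θ_J X₂ = −X₂` when `σ δ = −δ`. [cite: Weyl1939, Ch. II §10] -/
theorem formAdjoint_smul_add_inv_eq_neg (hJ : IsUnit J.det) {γ₀ : GL n K} (hγ₀ : γ₀ ∈ unitaryGroupOfForm σ J) {δ : K} (hδ : σ δ = -δ) :
    J⁻¹ * ((δ • ((γ₀ : Matrix n n K) + ((γ₀⁻¹ : GL n K) : Matrix n n K))).map σ)ᵀ * J =
      -(δ • ((γ₀ : Matrix n n K) + ((γ₀⁻¹ : GL n K) : Matrix n n K))) := by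
  rw [formAdjoint_smul, formAdjoint_add, formAdjoint_coe_eq_coe_inv σ hJ hγ₀,
    formAdjoint_coe_eq_coe_inv σ hJ ((unitaryGroupOfForm σ J).inv_mem hγ₀), inv_inv, hδ, neg_smul, add_comm]

/-- A `σ`-FIXED scalar multiple of a `θ_J`-skew matrix is `θ_J`-skew. [cite: Weyl1939, Ch. II §10] -/
theorem formAdjoint_smul_eq_neg_of_eq_neg {X : Matrix n n K} (hX : J⁻¹ * (X.map σ)ᵀ * J = -X) {ε : K} (hε : σ ε = ε) :
    J⁻¹ * ((ε • X).map σ)ᵀ * J = -(ε • X) := by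
  rw [formAdjoint_smul, hX, hε, smul_neg]

end Skew

section Cayley

variable {K : Type*} [Field K] {n : Type*} [Fintype n] [DecidableEq n] (σ : K →+* K) {J : Matrix n n K}

/-- **A Cayley transform in the centraliser**: if `X` commutes with a unitary `γ₀`, `θ_J X = −X` and `1 ± X` are invertible, then there is an element `u` of
`U(σ, J)` commuting with `γ₀` whose matrix is `c(X) = (1 − X)(1 + X)⁻¹` (★ `cayley_mem_unitaryGroupOfForm`, ★ `commute_cayley`). [cite: Weyl1939, Ch. II §10] -/
theorem exists_mem_centralizer_coe_eq_cayley (hJ : IsUnit J.det) {γ₀ : GL n K} (hγ₀ : γ₀ ∈ unitaryGroupOfForm σ J) {X : Matrix n n K}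
    (hXc : Commute X (γ₀ : Matrix n n K)) (hX : J⁻¹ * (X.map σ)ᵀ * J = -X) (hp : IsUnit (1 + X)) (hm : IsUnit (1 - X)) :
    ∃ u : ↥(Subgroup.centralizer ({⟨γ₀, hγ₀⟩} : Set ↥(unitaryGroupOfForm σ J))),
      (((u : ↥(unitaryGroupOfForm σ J)) : GL n K) : Matrix n n K) = cayley X := by
  obtain ⟨g, hgU, hg⟩ := cayley_mem_unitaryGroupOfForm σ hJ hX hp hm
  have hcomm : Commute (γ₀ : Matrix n n K) (cayley X) := commute_cayley hXc.symm hp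
  refine ⟨⟨⟨g, hgU⟩, ?_⟩, hg⟩
  rw [Subgroup.mem_centralizer_singleton_iff]
  apply Subtype.ext
  change g * γ₀ = γ₀ * g
  apply Units.ext
  rw [Units.val_mul, Units.val_mul, hg]
  exact hcomm.eq.symm

end Cayley

section NotOpen

/-- A subgroup avoided FREQUENTLY by a net `u → 1` is not open (an open subgroup is a neighbourhood of `1`, which the net enters eventually).
[cite: HarishChandra1970, Lemma 42] -/
theorem not_isOpen_subgroup_of_tendsto {G : Type*} [Group G] [TopologicalSpace G] (H : Subgroup G) {ι : Type*} {l : Filter ι} {u : ι → G}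
    (hu : Tendsto u l (𝓝 1)) (huH : ∃ᶠ k in l, u k ∉ H) : ¬ IsOpen (H : Set G) := by
  intro hopen
  obtain ⟨k, hk1, hk2⟩ := (huH.and_eventually (hu.eventually_mem (hopen.mem_nhds H.one_mem))).exists
  exact hk1 hk2

end NotOpen

section Main

variable {K : Type*} [NontriviallyNormedField K] [CompleteSpace K] {n : Type*} [Fintype n] [DecidableEq n]
  (σ : K →+* K) {J : Matrix n n K}

omit [CompleteSpace K] in
/-- Matrix inversion is continuous at `1` over a normed field (Mathlib `continuousAt_matrix_inv`). [cite: Weyl1939, Ch. II §10] -/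
theorem continuousAt_inv_one_matrix : ContinuousAt (Inv.inv : Matrix n n K → Matrix n n K) 1 := by
  refine continuousAt_matrix_inv (1 : Matrix n n K) ?_
  rw [Matrix.det_one, Ring.inverse_eq_inv']
  exact continuousAt_inv₀ one_ne_zero

omit [CompleteSpace K] in
/-- **Cayley transforms along a null sequence tend to `1`**: if `ε_k → 0` then `c(ε_k X) = (1 − ε_k X)(1 + ε_k X)⁻¹ → 1` in `M_n(K)`, and `1 ± ε_k X` are
invertible eventually. [cite: Weyl1939, Ch. II §10] -/
theorem tendsto_cayley_smul (X : Matrix n n K) {ε : ℕ → K} (hε : Tendsto ε atTop (𝓝 0)) :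
    Tendsto (fun k => cayley (ε k • X)) atTop (𝓝 1) ∧
      ∀ᶠ k in atTop, IsUnit (1 + ε k • X) ∧ IsUnit (1 - ε k • X) := by
  have h0 : Tendsto (fun k => ε k • X) atTop (𝓝 0) := by
    simpa only [zero_smul] using hε.smul_const X
  have hp : Tendsto (fun k => 1 + ε k • X) atTop (𝓝 1) := by simpa only [add_zero] using h0.const_add 1
  have hm : Tendsto (fun k => 1 - ε k • X) atTop (𝓝 1) := by simpa only [sub_zero] using h0.const_sub 1
  have hdet : Continuous fun A : Matrix n n K => A.det := continuous_id.matrix_det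
  have hdetp : Tendsto (fun k => (1 + ε k • X).det) atTop (𝓝 1) := by
    have h := (hdet.tendsto 1).comp hp
    simp only [Function.comp_def, Matrix.det_one] at h
    exact h
  have hdetm : Tendsto (fun k => (1 - ε k • X).det) atTop (𝓝 1) := by
    have h := (hdet.tendsto 1).comp hm
    simp only [Function.comp_def, Matrix.det_one] at h
    exact h
  refine ⟨?_, ?_⟩
  · have hinv : Tendsto (fun k => (1 + ε k • X)⁻¹) atTop (𝓝 1) := by
      have h := (continuousAt_inv_one_matrix (K := K) (n := n)).tendsto.comp hp
      simp only [Function.comp_def, inv_one] at h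
      exact h
    have h := hm.mul hinv
    simp only [mul_one] at h
    refine h.congr fun k => ?_
    rw [cayley_def, Matrix.nonsing_inv_eq_ringInverse]
  · filter_upwards [hdetp.eventually_ne one_ne_zero, hdetm.eventually_ne one_ne_zero] with k hkp hkm
    exact ⟨(Matrix.isUnit_iff_isUnit_det _).2 (isUnit_iff_ne_zero.2 hkp), (Matrix.isUnit_iff_isUnit_det _).2 (isUnit_iff_ne_zero.2 hkm)⟩

/-- **The singular locus of the centraliser of a regular unitary element lies in finitely many CLOSED, NON-OPEN subgroups (the root kernels).**  Let `γ₀ ∈ U(σ, J)`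
have separable characteristic polynomial, `2 ≠ 0` in `K`, `δ ≠ 0` with `σ δ = −δ`, and `ε_k → 0` non-zero `σ`-fixed scalars.  Then there is a finite set `s`
of subgroups of `T = Z_{U(σ,J)}(γ₀)`, each closed and not open in `T`, such that every `t ∈ T` whose characteristic polynomial is not separable lies in some
member of `s`. [cite: HarishChandra1970, Lemma 42] [cite: Rogawski1990, §3.6 pp. 28–31] [cite: Borel1991, IV.12.2] -/
theorem exists_finset_subgroup_cover_singular_centralizer (h2 : (2 : K) ≠ 0) (hJ : IsUnit J.det)
    {δ : K} (hσδ : σ δ = -δ) (hδ : δ ≠ 0)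
    {ε : ℕ → K} (hε : Tendsto ε atTop (𝓝 0)) (hε0 : ∀ k, ε k ≠ 0) (hσε : ∀ k, σ (ε k) = ε k)
    {γ₀ : GL n K} (hγ₀ : γ₀ ∈ unitaryGroupOfForm σ J) (hsep : (γ₀ : Matrix n n K).charpoly.Separable) :
    ∃ s : Finset (Subgroup ↥(Subgroup.centralizer ({⟨γ₀, hγ₀⟩} : Set ↥(unitaryGroupOfForm σ J)))),
      (∀ H ∈ s, IsClosed (H : Set ↥(Subgroup.centralizer ({⟨γ₀, hγ₀⟩} : Set ↥(unitaryGroupOfForm σ J)))) ∧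
        ¬ IsOpen (H : Set ↥(Subgroup.centralizer ({⟨γ₀, hγ₀⟩} : Set ↥(unitaryGroupOfForm σ J))))) ∧
      ∀ t : ↥(Subgroup.centralizer ({⟨γ₀, hγ₀⟩} : Set ↥(unitaryGroupOfForm σ J))),
        ¬ ((((t : ↥(unitaryGroupOfForm σ J)) : GL n K) : Matrix n n K).charpoly.Separable) → ∃ H ∈ s, t ∈ H := by
  classical
  -- notation
  set U := unitaryGroupOfForm σ J with hU
  set γ₀' : ↥U := ⟨γ₀, hγ₀⟩ with hγ₀'
  set T := Subgroup.centralizer ({γ₀'} : Set ↥U) with hT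
  let L := AlgebraicClosure K
  let φ : K →+* L := algebraMap K L
  have hφi : Function.Injective φ := (algebraMap K L).injective
  have h2L : (2 : L) ≠ 0 := by
    rw [show (2 : L) = φ 2 from (map_ofNat φ 2).symm]
    exact fun h => h2 (hφi (by rw [h, map_zero]))
  set g : Matrix n n K := (γ₀ : Matrix n n K) with hg
  -- the matrix of an element of `T`, and its basic properties
  let mat : ↥T → Matrix n n K := fun t => (((t : ↥U) : GL n K) : Matrix n n K)
  have hmat_cont : Continuous mat :=
    Units.continuous_val.comp (continuous_subtype_val.comp continuous_subtype_val)
  have hmat_comm : ∀ t : ↥T, Commute (mat t) g := fun t => by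
    have ht := Subgroup.mem_centralizer_singleton_iff.1 t.2
    have h1 : ((t : ↥U) : GL n K) * γ₀ = γ₀ * ((t : ↥U) : GL n K) := congrArg (fun x : ↥U => (x : GL n K)) ht
    exact congrArg (fun x : GL n K => (x : Matrix n n K)) h1
  have hmat_unit : ∀ t : ↥T, IsUnit (mat t) := fun t => Units.isUnit _
  have hmat_mul : ∀ t t' : ↥T, mat (t * t') = mat t * mat t' := fun _ _ => rfl
  have hmat_one : mat 1 = 1 := rfl
  have hmat_inv : ∀ t : ↥T, mat t⁻¹ = (mat t)⁻¹ := fun t => by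
    change (((((t : ↥U) : GL n K))⁻¹ : GL n K) : Matrix n n K) = _
    rw [Matrix.coe_units_inv]
  -- eigencharacters
  obtain ⟨χ, hχ1, hχmul, hχinj, hχsplit⟩ := exists_eigencharacters (L := L) g hsep
  -- the root kernels
  let Hker : n × n → Subgroup ↥T := fun p =>
    { carrier := {t | χ p.1 (mat t) = χ p.2 (mat t)}
      one_mem' := by simp only [Set.mem_setOf_eq, hmat_one, hχ1]
      mul_mem' := fun {a b} ha hb => by
        simp only [Set.mem_setOf_eq] at ha hb ⊢
        rw [hmat_mul, hχmul _ _ _ (hmat_comm a) (hmat_comm b), hχmul _ _ _ (hmat_comm a) (hmat_comm b), ha, hb]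
      inv_mem' := fun {a} ha => by
        simp only [Set.mem_setOf_eq] at ha ⊢
        rw [hmat_inv, eigencharacter_inv_of_isUnit (χ p.1) (hχ1 p.1) (hχmul p.1) (hmat_comm a) (hmat_unit a),
          eigencharacter_inv_of_isUnit (χ p.2) (hχ1 p.2) (hχmul p.2) (hmat_comm a) (hmat_unit a), ha] }
  have hHmem : ∀ p t, t ∈ Hker p ↔ χ p.1 (mat t) = χ p.2 (mat t) := fun _ _ => Iff.rfl
  -- closedness
  have hHclosed : ∀ p, IsClosed (Hker p : Set ↥T) := by
    intro p
    let Z : Submodule K (Matrix n n K) := LinearMap.ker (χ p.1 - χ p.2)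
    have hZ : IsClosed (Z : Set (Matrix n n K)) := Z.closed_of_finiteDimensional
    have hset : (Hker p : Set ↥T) = mat ⁻¹' (Z : Set (Matrix n n K)) := by
      ext t
      simp only [SetLike.mem_coe, hHmem, Set.mem_preimage, Z, LinearMap.mem_ker, LinearMap.sub_apply, sub_eq_zero]
    rw [hset]
    exact hZ.preimage hmat_cont
  -- non-openness for `i ≠ j`
  have hHnotopen : ∀ p : n × n, p.1 ≠ p.2 → ¬ IsOpen (Hker p : Set ↥T) := by
    rintro ⟨i, j⟩ hij
    -- the two skew elements of the commutant and the choice of `X`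
    set ginv : Matrix n n K := ((γ₀⁻¹ : GL n K) : Matrix n n K) with hginv
    have hginv_eq : ginv = g⁻¹ := by rw [hginv, hg, Matrix.coe_units_inv]
    have hcomm_ginv : Commute ginv g := Commute.units_inv_left (Commute.refl (γ₀ : Matrix n n K))
    have hχginv : ∀ k, χ k ginv = (χ k g)⁻¹ := fun k => by
      rw [hginv_eq]; exact eigencharacter_inv_of_isUnit (χ k) (hχ1 k) (hχmul k) (Commute.refl g) (Units.isUnit γ₀)
    have hαne : ∀ k, χ k g ≠ 0 := fun k => eigencharacter_ne_zero_of_isUnit (χ k) (hχ1 k) (hχmul k) (Commute.refl g) (Units.isUnit γ₀)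
    set X₁ : Matrix n n K := g - ginv with hX₁def
    set X₂ : Matrix n n K := δ • (g + ginv) with hX₂def
    have hX₁c : Commute X₁ g := (Commute.refl g).sub_left hcomm_ginv
    have hX₂c : Commute X₂ g := ((Commute.refl g).add_left hcomm_ginv).smul_left δ
    have hX₁s : J⁻¹ * (X₁.map σ)ᵀ * J = -X₁ := formAdjoint_sub_inv_eq_neg σ hJ hγ₀
    have hX₂s : J⁻¹ * (X₂.map σ)ᵀ * J = -X₂ := formAdjoint_smul_add_inv_eq_neg σ hJ hγ₀ hσδ
    have hχX₁ : ∀ k, χ k X₁ = χ k g - (χ k g)⁻¹ := fun k => by rw [hX₁def, map_sub, hχginv]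
    have hχX₂ : ∀ k, χ k X₂ = φ δ * (χ k g + (χ k g)⁻¹) := fun k => by
      rw [hX₂def, map_smul, map_add, hχginv, Algebra.smul_def]
    -- one of them separates `χ_i` from `χ_j`
    obtain ⟨X, hXc, hXs, hXij⟩ : ∃ X : Matrix n n K, Commute X g ∧ J⁻¹ * (X.map σ)ᵀ * J = -X ∧ χ i X ≠ χ j X := by
      by_cases h₁ : χ i X₁ = χ j X₁
      · refine ⟨X₂, hX₂c, hX₂s, fun h₂ => hij (hχinj ?_)⟩
        rw [hχX₁, hχX₁] at h₁
        rw [hχX₂, hχX₂] at h₂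
        have hφδ : φ δ ≠ 0 := fun h => hδ (hφi (by rw [h, map_zero]))
        have h₂' : χ i g + (χ i g)⁻¹ = χ j g + (χ j g)⁻¹ := mul_left_cancel₀ hφδ h₂
        have hsum : (2 : L) * χ i g = 2 * χ j g := by linear_combination h₁ + h₂'
        exact mul_left_cancel₀ h2L hsum
      · exact ⟨X₁, hX₁c, hX₁s, h₁⟩
    -- the Cayley sequence
    set Y : ℕ → Matrix n n K := fun k => ε k • X with hYdef
    have hYc : ∀ k, Commute (Y k) g := fun k => hXc.smul_left (ε k)
    have hYs : ∀ k, J⁻¹ * ((Y k).map σ)ᵀ * J = -(Y k) := fun k => formAdjoint_smul_eq_neg_of_eq_neg σ hXs (hσε k)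
    obtain ⟨hcay, hunits⟩ := tendsto_cayley_smul X hε
    have hex : ∀ k, ∃ t : ↥T, (IsUnit (1 + Y k) ∧ IsUnit (1 - Y k)) → mat t = cayley (Y k) := by
      intro k
      by_cases hk : IsUnit (1 + Y k) ∧ IsUnit (1 - Y k)
      · obtain ⟨t, ht⟩ := exists_mem_centralizer_coe_eq_cayley σ hJ hγ₀ (hYc k) (hYs k) hk.1 hk.2
        exact ⟨t, fun _ => ht⟩
      · exact ⟨1, fun h => absurd h hk⟩
    choose u hu using hex
    -- `u k → 1` in `T`
    have hmat_tend : Tendsto (fun k => mat (u k)) atTop (𝓝 1) := by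
      refine hcay.congr' ?_
      filter_upwards [hunits] with k hk
      exact (hu k hk).symm
    have hu_tend : Tendsto u atTop (𝓝 1) := by
      rw [tendsto_subtype_rng, tendsto_subtype_rng]
      change Tendsto (fun k => ((u k : ↥U) : GL n K)) atTop (𝓝 1)
      rw [Units.isEmbedding_embedProduct.tendsto_nhds_iff]
      simp only [Function.comp_def, Units.embedProduct_apply, Units.val_one, inv_one, MulOpposite.op_one]
      refine Tendsto.prodMk_nhds hmat_tend ?_
      have hinv : Tendsto (fun k => (mat (u k))⁻¹) atTop (𝓝 1) := by
        have h := (continuousAt_inv_one_matrix (K := K) (n := n)).tendsto.comp hmat_tend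
        simp only [Function.comp_def, inv_one] at h
        exact h
      have hinv' : Tendsto (fun k => ((((u k : ↥U) : GL n K)⁻¹ : GL n K) : Matrix n n K)) atTop (𝓝 1) := by
        refine hinv.congr fun k => ?_
        rw [Matrix.coe_units_inv]
      have h := (MulOpposite.continuous_op.tendsto (1 : Matrix n n K)).comp hinv'
      simp only [Function.comp_def, MulOpposite.op_one] at h
      exact h
    -- `u k ∉ H_{ij}` eventually
    have hnot : ∃ᶠ k in atTop, u k ∉ Hker (i, j) := by
      refine Eventually.frequently ?_
      filter_upwards [hunits] with k hk hmem
      rw [hHmem] at hmem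
      simp only at hmem
      rw [hu k hk] at hmem
      -- evaluate the eigencharacters on the Cayley transform
      have hpY : Commute (1 + Y k) g := (Commute.one_left g).add_left (hYc k)
      have hmY : Commute (1 - Y k) g := (Commute.one_left g).sub_left (hYc k)
      have hinvY : Commute (1 + Y k)⁻¹ g := by
        obtain ⟨w, hw⟩ := hk.1
        rw [← hw, ← Matrix.coe_units_inv]
        exact Commute.units_inv_left (hw ▸ hpY)
      have hcayk : cayley (Y k) = (1 - Y k) * (1 + Y k)⁻¹ := by rw [cayley_def, Matrix.nonsing_inv_eq_ringInverse]
      have hplus : ∀ l, χ l (1 + Y k) = 1 + φ (ε k) * χ l X := fun l => by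
        rw [map_add, hχ1, hYdef, map_smul, Algebra.smul_def]
      have hminus : ∀ l, χ l (1 - Y k) = 1 - φ (ε k) * χ l X := fun l => by
        rw [map_sub, hχ1, hYdef, map_smul, Algebra.smul_def]
      have hval : ∀ l, χ l (cayley (Y k)) = (1 - φ (ε k) * χ l X) * (1 + φ (ε k) * χ l X)⁻¹ := fun l => by
        rw [hcayk, hχmul l _ _ hmY hinvY, eigencharacter_inv_of_isUnit (χ l) (hχ1 l) (hχmul l) hpY hk.1, hplus, hminus]
      have hne : ∀ l, 1 + φ (ε k) * χ l X ≠ 0 := fun l => by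
        rw [← hplus]
        exact eigencharacter_ne_zero_of_isUnit (χ l) (hχ1 l) (hχmul l) hpY hk.1
      rw [hval i, hval j, ← div_eq_mul_inv, ← div_eq_mul_inv, div_eq_div_iff (hne i) (hne j)] at hmem
      have hεL : φ (ε k) ≠ 0 := fun h => hε0 k (hφi (by rw [h, map_zero]))
      have hzero : (2 : L) * φ (ε k) * (χ j X - χ i X) = 0 := by linear_combination hmem
      rcases mul_eq_zero.1 hzero with h | h
      · rcases mul_eq_zero.1 h with h' | h'
        · exact h2L h'
        · exact hεL h'
      · exact hXij (sub_eq_zero.1 h).symm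
    exact not_isOpen_subgroup_of_tendsto (Hker (i, j)) hu_tend hnot
  -- the finite family and the covering
  refine ⟨(Finset.univ.filter fun p : n × n => p.1 ≠ p.2).image Hker, ?_, ?_⟩
  · intro H hH
    obtain ⟨p, hp, rfl⟩ := Finset.mem_image.1 hH
    exact ⟨hHclosed p, hHnotopen p (Finset.mem_filter.1 hp).2⟩
  · intro t ht
    obtain ⟨i, j, hij, hχij⟩ := exists_eq_of_not_separable_of_splits (mat t) (fun l => χ l (mat t)) (hχsplit (mat t) (hmat_comm t)) ht
    exact ⟨Hker (i, j), Finset.mem_image.2 ⟨(i, j), Finset.mem_filter.2 ⟨Finset.mem_univ _, hij⟩, rfl⟩, (hHmem _ _).2 hχij⟩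

end Main

end Literature.LinearAlgebra.Matrix

end
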